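import Literature.AlgebraicGeometry.AbelianSchemes.WeilDualityTwoBlockCut              -- ★ (H2) ED. 3 `exists_twoBlock_hermitianDuality_pairing` (currency), ★ `weilChar`, ★ `cartierPairing`
import Literature.AlgebraicGeometry.AbelianSchemes.WeilUnitKernelIsotropicOfDescent    -- ★ (ISO-q) `weilUnit_comp_lam_eq_one_of_comp_eq_one`
import Literature.AlgebraicGeometry.GroupSchemes.CartierDualLagrangian                 -- ★ Lagrangian by rank (annihilator form)
import Literature.AlgebraicGeometry.GroupSchemes.HopfIdealClosedSubgroup               -- ★ `isoSpecOver`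
import HarnessLib

/-!
# The kernel of a homomorphism through which `n·λ` descends, realised inside a self-dual layer `G′ ⊂ A[n]` whose duality IS `e_n(·, λ·)`,
# is ISOTROPIC, and LAGRANGIAN when of half rank — in the points form of ★ (BLK) ([Mumford AV] §23 Thm. 2; [Tate 1997] §(3.8))

Topic `Literature/AlgebraicGeometry/AbelianSchemes`; namespaces `Literature.AlgebraicGeometry.GroupSchemes.AffineGroupScheme` (§1) and
`Literature.AlgebraicGeometry.AbelianSchemes.AbelianSchemeOver.DualPair` (§2–§3).  THEOREMS ONLY (no definition, no named fact, no instance, no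
notation, no `sorry`).  Cell `hodgecm-mathlib` (D-0151), F0∕P6 «MOD», line L2 (socket `stub_DOWN`), organ **(LAG) «KERNEL LAGRANGIAN IN (BLK) FORM»**,
piece (LAG-c) (LA2-plan (g2) FIRST RULINGS (R2) 2026-09-02T07:12:37Z): the seam between the isotropy source ★ (ISO-q) `weilUnit_comp_lam_eq_one_of_comp_eq_one`
(currency `weilUnit`) and the consumer ★ (BLK) `exists_comp_eq_iff_of_lagrangian_of_blocks` (currency: a duality `e : G′ ≅ G′^D` and its points-form Lagrangian
clause `(∃ s, s ≫ κ = t) ↔ (t ≫ e.hom) ≫ κ^D = 1`), through the pairing-value clause of ★ (H2) ED. 3 `exists_twoBlock_hermitianDuality_pairing`.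
`--supports stmt-HodgeConjecture-24832`, count-neutral.  HONEST LABEL: HC_CM is proved only modulo the printed citations (2 remaining named inputs hLiu418 24832,
h413 24833) until rung 0 closes; this file is generic and discharges none of them.

## Mathematics

Let `k` be a field, `A∕k` an abelian variety with a normalised dual pair `D = (Â, 𝒫)` and a polarization `λ`, `B∕k` with a normalised dual pair and a
homomorphism `λ_B : B → B̂`, and `r : A → B` a homomorphism through which `n·λ` DESCENDS: `r ≫ λ_B ≫ r^∨ = λ ≫ [n]` (`n ≠ 0`).  Let `j′ : G′ ↪ A` be a
homomorphic realisation of a finite layer killed by `n` with a duality `e : G′ ≅ G′^D` whose canonical pairing values on points over finite `k`-algebras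
are the Weil characters of `λ`: `⟪t ≫ e, s⟫ = e_n(s ≫ j′, (t ≫ j′) ≫ λ)` (★ `weilChar`; for `G′ = A[𝔭_w𝔭_{c•w}]` this is ★ `exists_twoBlock_hermitianDuality_pairing`).
Let `κ : K → G′` be a homomorphism of finite commutative group schemes KILLED BY `r`: `κ ≫ j′ ≫ r = 1`.
* ISOTROPY (§2): `(κ ≫ e) ≫ κ^D = 1` — the character `e(κ)` of `G′` is trivial on `K`.  A point of `K^D` over the finite algebra `Γ(K)` is `1` iff its
  pairing value with the tautological point over `Γ(K) ⊗ Γ(K)` is `1` (★ `eq_of_cartierPairing_tautPt_eq`); by adjunction (★ `cartierPairing_comp_cartierDualMap`)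
  and the pairing clause that value is `e_n(s ≫ j′, (t ≫ j′) ≫ λ)` for two points `s, t` of `K`, i.e. (★ `weilChar_eq`) the Weil unit `e_n(x, y ≫ λ)` of the
  section `x` of the `r`-killed point `s ≫ j′` against the `r`-killed point `y = t ≫ j′` — which is `1` by ★ (ISO-q) ([MumfordAV1970] §23 Thm. 2).
* LAGRANGIAN (§1, §3): if moreover `κ` is a closed immersion and `rk G′ = (rk K)²`, then `K^⊥ = K` (★ `CartierDualLagrangian`), which in points reads
  `(∃ s, s ≫ κ = t) ↔ (t ≫ e) ≫ κ^D = 1` (★ `exists_comp_kerι_eq_iff` on `K^⊥ = Ker κ^D`) — VERBATIM the `hlagᵢ` input of ★ (BLK).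

* §1 `exists_comp_eq_iff_comp_cartierDualMap_eq_one_of_finrank` — (BLK)'s points form from «pairs trivially with itself» + half rank (finite group schemes);
* §2 `cartierPairing_comp_cartierDualMap_eq_one_of_descent` (all pairing values of `e(κ)|_K` on finite points are `1`) and
  **`comp_cartierDualMap_eq_one_of_descent`** — ISOTROPY of an `r`-killed `K → G′` for a duality with the `e_n(·, λ·)` clause;
* §3 **`exists_comp_eq_iff_of_descent`** — THE HEAD: (BLK)'s `hlagᵢ` for such `K` of half rank.

## References
* [MumfordAV1970] D. Mumford, *Abelian Varieties* (1970), §23 Thm. 2 (p. 231), §20 (I) (pp. 184–189), §15 Thm. 1 (p. 143).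
* [Tate1997FiniteFlatGroupSchemes] J. Tate, *Finite flat group schemes* (1997), §(3.8) pp. 145–146.
* [Oda1969] T. Oda, *The first de Rham cohomology group and Dieudonné modules*, Ann. Sci. ÉNS (4) 2 (1969), Cor. 1.3.
-/

set_option autoImplicit false

-- Mathlib's `Over`/`Scheme` APIs are stated across semireducible wrappers (as in the ★ `GroupSchemes/*` files).
set_option backward.isDefEq.respectTransparency false

noncomputable section

universe u

open CategoryTheory CategoryTheory.Limits AlgebraicGeometry MonoidalCategory CartesianMonoidalCategory TensorProduct
open scoped MonObj

/-! ## §1 Finite group schemes: «pairs trivially with itself» + half rank ⟹ (BLK)'s points-form Lagrangian clause -/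

namespace Literature.AlgebraicGeometry.GroupSchemes

namespace AffineGroupScheme

open Literature.AlgebraicGeometry.Motives GroupSchemeKernel

variable {k : Type u} [Field k] {K G : SchemeOver k}
  [GrpObj K] [IsCommMonObj K] [IsAffine K.left] [Module.Free k (Alg K)] [Module.Finite k (Alg K)]
  [GrpObj G] [IsCommMonObj G] [IsAffine G.left] [Module.Free k (Alg G)] [Module.Finite k (Alg G)]
  (κ : K ⟶ G) [IsMonHom κ] [IsClosedImmersion κ.left] (e : G ≅ cartierDual G)

/-- **LAGRANGIAN BY RANK, (BLK) points form.**  `e : G ≅ G^D` a duality of a finite commutative group scheme over a field, `κ : K ↪ G` a closed subgroup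
with `(κ ≫ e) ≫ κ^D = 1` (isotropic) and `rk G = rk K · rk K` (half rank) ⟹ a `T`-point `t` of `G` factors through `κ` iff the character `e(t)` is trivial
on `K`: `(∃ s, s ≫ κ = t) ↔ (t ≫ e) ≫ κ^D = 1` — ★ `exists_comp_annihilatorι_comp_inv_iff_of_comp_cartierDualMap_eq_one_of_finrank` read through
`K^⊥ = Ker κ^D` (★ `exists_comp_kerι_eq_iff`); VERBATIM the hypotheses `hlag₁`∕`hlag₂` of ★ (BLK) `exists_comp_eq_iff_of_lagrangian_of_blocks`.
[cite: Tate1997FiniteFlatGroupSchemes, §(3.8) p. 146] [cite: MumfordAV1970, §23 Thm. 2 (p. 231)] [cite: Oda1969, Cor. 1.3] -/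
theorem exists_comp_eq_iff_comp_cartierDualMap_eq_one_of_finrank
    (h1 : (κ ≫ e.hom) ≫ cartierDualMap κ = 1)
    (hrk : Module.finrank k (Alg G) = Module.finrank k (Alg K) * Module.finrank k (Alg K))
    {T : SchemeOver k} (t : T ⟶ G) :
    (∃ s : T ⟶ K, s ≫ κ = t) ↔ (t ≫ e.hom) ≫ cartierDualMap κ = 1 := by
  rw [← exists_comp_annihilatorι_comp_inv_iff_of_comp_cartierDualMap_eq_one_of_finrank κ e h1 hrk t,
    exists_eq_comp_annihilatorι_comp_inv_iff_exists]
  constructor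
  · rintro ⟨c, hc⟩
    rw [← hc, Category.assoc, annihilatorι_comp, MonObj.comp_one]
  · intro ht
    exact ⟨kerLift (f := cartierDualMap κ) (t ≫ e.hom) ht, by rw [annihilatorι_def, kerLift_ι]⟩

end AffineGroupScheme

end Literature.AlgebraicGeometry.GroupSchemes

/-! ## §2–§3 Abelian varieties: the kernel of a descent of `n·λ` inside a layer whose duality is `e_n(·, λ·)` -/

namespace Literature.AlgebraicGeometry.AbelianSchemes

namespace AbelianSchemeOver

namespace DualPair

open Literature.AlgebraicGeometry.GroupSchemes Literature.AlgebraicGeometry.GroupSchemes.GroupSchemeKernel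
open Literature.AlgebraicGeometry.GroupSchemes.AffineGroupScheme
open Literature.AlgebraicGeometry.Motives Literature.AlgebraicGeometry.Motives.AbelianVariety
open Literature.AlgebraicGeometry.AbelianSchemes.WeilPairing

variable {k : Type u} [Field k]

section Descent

variable (n : ℕ) (A : AbelianVariety k)
  (D : (AbelianScheme.ofAbelianVariety A).toOver.DualPair)
  (hD : Nonempty ((Scheme.Modules.pullback D.unitHatSlice).obj D.P ≅ SheafOfModules.unit _))
  (pol : (AbelianScheme.ofAbelianVariety A).toOver.Polarization D)
  -- the target `B` of the homomorphism with its dual pair and `λ_B`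
  (B : AbelianVariety k) (DB : (AbelianScheme.ofAbelianVariety B).toOver.DualPair)
  (hDB : Nonempty ((Scheme.Modules.pullback DB.unitHatSlice).obj DB.P ≅ SheafOfModules.unit _))
  (lamB : B.X ⟶ DB.hat.X) [IsMonHom lamB]
  -- the homomorphism `r : A → B` through which `n·λ` descends
  (r : A.X ⟶ B.X) [IsMonHom r]
  -- the layer `j′ : G′ → A`, killed by `n`, with its duality `e` and the `e_n(·, λ·)` pairing clause on finite points
  (G' : SchemeOver k) [GrpObj G'] [IsCommMonObj G'] [IsAffine G'.left] [Module.Free k (Alg G')] [Module.Finite k (Alg G')]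
  (j' : G' ⟶ A.X) (e : G' ≅ cartierDual G')
  -- the `r`-killed subgroup `κ : K → G′`
  (K : SchemeOver k) [GrpObj K] [IsCommMonObj K] [IsAffine K.left] [Module.Free k (Alg K)] [Module.Finite k (Alg K)]
  (κ : K ⟶ G') [IsMonHom κ]

include hDB in
/-- **ALL PAIRING VALUES OF THE CHARACTER `e(κ)|_K` ARE `1`** (the heart of §2): with the data of `comp_cartierDualMap_eq_one_of_descent`, for every
FINITE `k`-algebra `T` and points `t₀, s₀ ∈ K(T)`: `⟪t₀ ≫ κ ≫ e ≫ κ^D, s₀⟫ = ⟪(t₀ ≫ κ) ≫ e, s₀ ≫ κ⟫` (★ `cartierPairing_comp_cartierDualMap`)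
`= e_n((s₀ ≫ κ) ≫ j′, ((t₀ ≫ κ) ≫ j′) ≫ λ)` (the clause `he`) `=` the Weil unit of the section of the `r`-killed point `(s₀ ≫ κ) ≫ j′` against
`λ` of the `r`-killed point `(t₀ ≫ κ) ≫ j′` (★ `weilChar_eq`) `= 1` (★ (ISO-q) `weilUnit_comp_lam_eq_one_of_comp_eq_one`, from the descent row `hSIM`).
[cite: MumfordAV1970, §23 Thm. 2 (p. 231), §20 (I) (p. 186)] [cite: Tate1997FiniteFlatGroupSchemes, §(3.8) p. 145] -/
theorem cartierPairing_comp_cartierDualMap_eq_one_of_descent (hn : n ≠ 0)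
    (hSIM : r ≫ lamB ≫ dualIsogenyOver (A' := (AbelianScheme.ofAbelianVariety A).toOver) (B := (AbelianScheme.ofAbelianVariety B).toOver) r D DB =
      pol.lam ≫ D.hat.mulN n)
    (hG' : ∀ ⦃T : SchemeOver k⦄ (t : T ⟶ G'), (t ≫ j') ^ n = 1)
    (he : ∀ ⦃T : Type u⦄ [CommRing T] [Algebra k T] [Module.Finite k T] (t s : specOver k T ⟶ G')
      (ht : ((t ≫ j') ≫ pol.lam) ^ n = 1) (hs : (s ≫ j') ^ n = 1),
      cartierPairing G' (t ≫ e.hom) s = D.weilChar hD n ((t ≫ j') ≫ pol.lam) ht (s ≫ j') hs)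
    (hκ : (κ ≫ j') ≫ r = 1)
    {T : Type u} [CommRing T] [Algebra k T] [Module.Finite k T] (t₀ s₀ : specOver k T ⟶ K) :
    cartierPairing K (t₀ ≫ (κ ≫ e.hom) ≫ cartierDualMap κ) s₀ = 1 := by
  -- (0) instances: `λ` a homomorphism; `Spec T` locally Noetherian; the abelian schemes and their base changes commutative
  haveI := pol.isMonHom
  haveI : IsLocallyNoetherian (Spec (CommRingCat.of T)) := isLocallyNoetherian_spec_of_finite (k := k) T
  haveI : IsLocallyNoetherian (specOver k T).left := ‹IsLocallyNoetherian (Spec (CommRingCat.of T))›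
  haveI : IsCommMonObj (AbelianScheme.ofAbelianVariety A).toOver.X := (AbelianScheme.ofAbelianVariety A).toOver.isCommMonObj_of_isReduced_base
  haveI : IsCommMonObj (AbelianScheme.ofAbelianVariety B).toOver.X := (AbelianScheme.ofAbelianVariety B).toOver.isCommMonObj_of_isReduced_base
  haveI : IsCommMonObj ((AbelianScheme.ofAbelianVariety A).toOver.baseChange (specOver k T).hom).X := isCommMonObj_baseChange_of_field _
  haveI : IsCommMonObj ((AbelianScheme.ofAbelianVariety B).toOver.baseChange (specOver k T).hom).X := isCommMonObj_baseChange_of_field _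
  -- (1) the two `r`-killed points `(t₀ ≫ κ) ≫ j′`, `(s₀ ≫ κ) ≫ j′` of `A` and their torsion witnesses
  have hκ' : κ ≫ j' ≫ r = 1 := by simpa only [Category.assoc] using hκ
  have ht : (((t₀ ≫ κ) ≫ j') ≫ pol.lam) ^ n = 1 := by rw [← MonObj.pow_comp, hG' (t₀ ≫ κ), MonObj.one_comp]
  have hs : ((s₀ ≫ κ) ≫ j') ^ n = 1 := hG' (s₀ ≫ κ)
  have hty : ((t₀ ≫ κ) ≫ j') ≫ r = 1 := by rw [Category.assoc, Category.assoc, hκ', MonObj.comp_one]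
  have hsy : ((s₀ ≫ κ) ≫ j') ≫ r = 1 := by rw [Category.assoc, Category.assoc, hκ', MonObj.comp_one]
  -- (2) ★ (ISO-q): the Weil unit of the section of `(s₀ ≫ κ) ≫ j′` against `λ((t₀ ≫ κ) ≫ j′)` is `1`
  have hx : (((AbelianScheme.ofAbelianVariety A).toOver.ptTorsionSection n (specOver k T).hom ((s₀ ≫ κ) ≫ j') hs :
        ((AbelianScheme.ofAbelianVariety A).toOver.baseChange (specOver k T).hom).torsionSections n) :
        ((AbelianScheme.ofAbelianVariety A).toOver.baseChange (specOver k T).hom).Sections) ≫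
      baseChangeHom (A := (AbelianScheme.ofAbelianVariety A).toOver) (B := (AbelianScheme.ofAbelianVariety B).toOver) r (specOver k T).hom = 1 := by
    rw [coe_ptTorsionSection, ptSection_comp_baseChangeHom, hsy, ptSection_one]
  have hiso := weilUnit_comp_lam_eq_one_of_comp_eq_one (A := (AbelianScheme.ofAbelianVariety A).toOver)
    (C := (AbelianScheme.ofAbelianVariety B).toOver) r D DB hD hDB n pol.lam lamB (specOver k T).hom hn hSIM _ hx ((t₀ ≫ κ) ≫ j') hty ht
  -- (3) adjunction, the clause `he`, ★ `weilChar_eq`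
  rw [← Category.assoc t₀ (κ ≫ e.hom) (cartierDualMap κ), cartierPairing_comp_cartierDualMap K κ, ← Category.assoc t₀ κ e.hom,
    he (t₀ ≫ κ) (s₀ ≫ κ) ht hs, weilChar_eq, hiso, map_one]

include hDB in
/-- **ISOTROPY OF AN `r`-KILLED SUBGROUP FOR A DUALITY WHICH IS `e_n(·, λ·)`.**  Over a field `k`: `A` with a normalised dual pair `D` and a polarization
`λ`; `B` with a normalised dual pair and a homomorphism `λ_B`; a homomorphism `r : A → B` with the DESCENT ROW `r ≫ λ_B ≫ r^∨ = λ ≫ [n]` (`n ≠ 0`; ★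
`dualIsogenyOver`, ★ `mulN` — the (r3)∕SIM row shape of ★ `RoofTargetUnique` ∕ the P6a reader `Roof₀`); a layer `j′ : G′ → A` (any morphism) killed by `n`
(`hG′`) with a duality `e : G′ ≅ G′^D` whose pairing values on points over finite `k`-algebras are `⟪t ≫ e, s⟫ = e_n(s ≫ j′, (t ≫ j′) ≫ λ)` (`he`, ★
`weilChar`; token shape of ★ `exists_twoBlock_hermitianDuality_pairing`); and a homomorphism `κ : K → G′` of finite commutative group schemes KILLED BY `r`
(`hκ : (κ ≫ j′) ≫ r = 1`).  THEN `K` PAIRS TRIVIALLY WITH ITSELF under `e`: `(κ ≫ e) ≫ κ^D = 1`.  (Read at the universal point of `K` over the finite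
algebra `Γ(K)` — ★ `isoSpecOver` —, a point of `K^D` is `1` iff its pairing value with the tautological point over `Γ(K) ⊗ Γ(K)` is `1`, ★
`eq_of_cartierPairing_tautPt_eq`; that value is `1` by `cartierPairing_comp_cartierDualMap_eq_one_of_descent`.)
[cite: MumfordAV1970, §23 Thm. 2 (p. 231), §20 (I) (p. 186)] [cite: Tate1997FiniteFlatGroupSchemes, §(3.8) p. 145] -/
theorem comp_cartierDualMap_eq_one_of_descent (hn : n ≠ 0)
    (hSIM : r ≫ lamB ≫ dualIsogenyOver (A' := (AbelianScheme.ofAbelianVariety A).toOver) (B := (AbelianScheme.ofAbelianVariety B).toOver) r D DB =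
      pol.lam ≫ D.hat.mulN n)
    (hG' : ∀ ⦃T : SchemeOver k⦄ (t : T ⟶ G'), (t ≫ j') ^ n = 1)
    (he : ∀ ⦃T : Type u⦄ [CommRing T] [Algebra k T] [Module.Finite k T] (t s : specOver k T ⟶ G')
      (ht : ((t ≫ j') ≫ pol.lam) ^ n = 1) (hs : (s ≫ j') ^ n = 1),
      cartierPairing G' (t ≫ e.hom) s = D.weilChar hD n ((t ≫ j') ≫ pol.lam) ht (s ≫ j') hs)
    (hκ : (κ ≫ j') ≫ r = 1) :
    (κ ≫ e.hom) ≫ cartierDualMap κ = 1 := by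
  -- read the character at the universal point of `K` over `Γ(K)` and separate by the tautological point over `Γ(K) ⊗ Γ(K)`
  have key : (isoSpecOver K).inv ≫ ((κ ≫ e.hom) ≫ cartierDualMap κ) = 1 := by
    apply eq_of_cartierPairing_tautPt_eq K
    rw [MonObj.comp_one, cartierPairing_one_left, ← Category.assoc _ (isoSpecOver K).inv]
    exact cartierPairing_comp_cartierDualMap_eq_one_of_descent n A D hD pol B DB hDB lamB r G' j' e K κ hn hSIM hG' he hκ _ _
  rw [← cancel_epi (isoSpecOver K).inv, key, MonObj.comp_one]

include hDB in
/-- **HEAD (LAG) — THE `r`-KILLED SUBGROUP OF HALF RANK IS LAGRANGIAN, (BLK) POINTS FORM.**  Same data as `comp_cartierDualMap_eq_one_of_descent`, with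
`κ : K ↪ G′` a closed immersion and `rk G′ = rk K · rk K`.  THEN for every `T`-point `t` of `G′`: `t` factors through `κ` iff the character `e(t)` is
trivial on `K` — `(∃ s, s ≫ κ = t) ↔ (t ≫ e) ≫ κ^D = 1` —, VERBATIM the hypothesis `hlagᵢ` of ★ (BLK) `exists_comp_eq_iff_of_lagrangian_of_blocks` for
`Kᵢ = Ker r̄ᵢ` realised in `G′ = A[𝔭_w𝔭_{c•w}]` ((ρ2) of line L2: two reduced quotient homomorphisms with `r̄ᵢ^*λᵢ = p·λ` and the same `c•w`-dock part have
the same kernel).  §2 (isotropy) + §1 (Lagrangian by rank).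
[cite: MumfordAV1970, §23 Thm. 2 (p. 231)] [cite: Tate1997FiniteFlatGroupSchemes, §(3.8) pp. 145–146] [cite: Oda1969, Cor. 1.3] -/
theorem exists_comp_eq_iff_of_descent [IsClosedImmersion κ.left] (hn : n ≠ 0)
    (hSIM : r ≫ lamB ≫ dualIsogenyOver (A' := (AbelianScheme.ofAbelianVariety A).toOver) (B := (AbelianScheme.ofAbelianVariety B).toOver) r D DB =
      pol.lam ≫ D.hat.mulN n)
    (hG' : ∀ ⦃T : SchemeOver k⦄ (t : T ⟶ G'), (t ≫ j') ^ n = 1)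
    (he : ∀ ⦃T : Type u⦄ [CommRing T] [Algebra k T] [Module.Finite k T] (t s : specOver k T ⟶ G')
      (ht : ((t ≫ j') ≫ pol.lam) ^ n = 1) (hs : (s ≫ j') ^ n = 1),
      cartierPairing G' (t ≫ e.hom) s = D.weilChar hD n ((t ≫ j') ≫ pol.lam) ht (s ≫ j') hs)
    (hκ : (κ ≫ j') ≫ r = 1)
    (hrk : Module.finrank k (Alg G') = Module.finrank k (Alg K) * Module.finrank k (Alg K))
    ⦃T : SchemeOver k⦄ (t : T ⟶ G') :
    (∃ s : T ⟶ K, s ≫ κ = t) ↔ (t ≫ e.hom) ≫ cartierDualMap κ = 1 :=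
  exists_comp_eq_iff_comp_cartierDualMap_eq_one_of_finrank κ e
    (comp_cartierDualMap_eq_one_of_descent n A D hD pol B DB hDB lamB r G' j' e K κ hn hSIM hG' he hκ) hrk t

end Descent

end DualPair

end AbelianSchemeOver

end Literature.AlgebraicGeometry.AbelianSchemes

end
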